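import Literature.Analysis.PDE.SymmetricHyperbolicEnergy
import Literature.Analysis.FunctionSpaces.Mollification
import HarnessLib

/-!
# Mollifiers on `L²(ℝⁿ; W)`: kernel derivatives, Young and Cauchy–Schwarz bounds,
# self-adjointness, commutation with derivatives of smooth fields, and the rate `‖J_ε h − h‖₂ ≤ C ε ‖∇h‖₂`
# (topic `Analysis/PDE`)

Analytic layer of the energy-method existence theory for linear first-order symmetric hyperbolic
systems (Friedrichs 1954), built to discharge the named fact
`Literature.Geometry.Lorentzian.KerrSchild.waveCauchyProblem`. Friedrichs' regularisation solves
`∂ₜU = J_ε 𝒫 J_ε U` as an ordinary differential equation in `L²` and passes to the limit `ε → 0`;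
this file records the properties of the mollifier `J_ρ f = ρ ⋆ f` (`ρ` a smooth compactly
supported real kernel, e.g. a normalised bump `φ.normed`, Mathlib's `ContDiffBump.normed`, or one
of its coordinate derivatives) that this requires, for `W`-valued fields on `ℝⁿ = EuclideanSpace ℝ ι`
(Evans, *PDE*, App. C.4, Thm. 7; Adams, *Sobolev Spaces*, Lemma 2.18; Friedrichs 1944, the
"mollifier"):

* `cwd_convolution_eq_convolution_cwd_kernel` — derivatives fall on the kernel:
  `∂_v (ρ ⋆ f) = (∂_v ρ) ⋆ f` for locally integrable `f` (Mathlib's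
  `HasCompactSupport.hasFDerivAt_convolution_left`, iterated along words);
* `memLp_convolution_kernel`, `l2norm_convolution_kernel_le` — Young: `‖ρ ⋆ f‖₂ ≤ ‖ρ‖₁ ‖f‖₂`
  (from the tree's `eLpNorm_convolution_le_lintegral_enorm_mul`), hence `‖J f‖₂ ≤ ‖f‖₂` for a
  unit-mass nonnegative kernel;
* `norm_convolution_kernel_apply_le` — Cauchy–Schwarz pointwise: `‖(ρ ⋆ f)(x)‖ ≤ ‖ρ‖₂ ‖f‖₂`;
* `integral_inner_convolution_kernel_comm` — self-adjointness on `L²` for an even kernel: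
  `∫ ⟪f, ρ ⋆ g⟫ = ∫ ⟪ρ ⋆ f, g⟫`;
* `cwd_convolution_eq_convolution_cwd` — for a *smooth* field the derivatives may be put on the
  field instead: `∂_v (ρ ⋆ h) = ρ ⋆ ∂_v h` (differentiation under the integral sign);
* `l2norm_normed_convolution_sub_self_le` — the rate of approximation
  `‖φ.normed ⋆ h − h‖₂ ≤ rOut · Σⱼ ‖∂ⱼ h‖₂` for `C¹` fields with square-integrable gradient
  (Cauchy–Schwarz against the unit-mass kernel and along segments, Tonelli, translation
  invariance), and its sup-norm companion `norm_normed_convolution_sub_self_le`.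

Everything is proved; no named fact and no `sorry` is introduced.

## References

* K. O. Friedrichs, *The identity of weak and strong extensions of differential operators*,
  Trans. Amer. Math. Soc. 55 (1944) 132–151 (mollifiers). [Friedrichs1944]
* K. O. Friedrichs, *Symmetric hyperbolic linear differential equations*, Comm. Pure Appl. Math.
  7 (1954) 345–392. [Friedrichs1954]
* L. C. Evans, *Partial Differential Equations*, 2nd ed., AMS 2010, App. C.4, Thm. 7, and
  §5.3.1. [Evans2010]
* R. A. Adams, *Sobolev Spaces*, Academic Press 1975, Lemma 2.18. [Adams1975]
-/

noncomputable section

open MeasureTheory Set Function Filter Metric ContinuousLinearMap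
open scoped ContDiff Topology RealInnerProductSpace ENNReal NNReal Convolution

namespace Literature.Analysis.PDE

open Literature.Analysis.FunctionSpaces

variable {ι : Type*} [Fintype ι] [DecidableEq ι]
variable {W : Type*} [NormedAddCommGroup W] [NormedSpace ℝ W]

/-! ### Derivatives fall on the kernel -/

section KernelDeriv

omit [DecidableEq ι] in
/-- **One derivative on the kernel**: for a `C¹` compactly supported real kernel `ρ` and a locally
integrable `f`, `∂ⱼ (ρ ⋆ f) = (∂ⱼ ρ) ⋆ f` (Evans, *PDE*, App. C.4, Thm. 7 (i); Mathlib's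
`HasCompactSupport.hasFDerivAt_convolution_left`, evaluated on the frame vector).
[cite: Evans2010, App. C.4 Thm. 7] -/
theorem fderiv_convolution_kernel_apply {ρ : EuclideanSpace ℝ ι → ℝ} (hρ : ContDiff ℝ 1 ρ)
    (hρc : HasCompactSupport ρ) {f : EuclideanSpace ℝ ι → W}
    (hf : LocallyIntegrable f (volume : Measure (EuclideanSpace ℝ ι))) (x : EuclideanSpace ℝ ι)
    (j : ι) :
    fderiv ℝ (ρ ⋆[lsmul ℝ ℝ, volume] f) x (bv j) =
      ((fun y ↦ fderiv ℝ ρ y (bv j)) ⋆[lsmul ℝ ℝ, volume] f) x := by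
  have hD := hρc.hasFDerivAt_convolution_left (lsmul ℝ ℝ : ℝ →L[ℝ] W →L[ℝ] W) hρ hf x
  rw [hD.fderiv]
  have hint : ConvolutionExistsAt (fderiv ℝ ρ) f x
      ((lsmul ℝ ℝ : ℝ →L[ℝ] W →L[ℝ] W).precompL (EuclideanSpace ℝ ι)) volume :=
    (hρc.fderiv ℝ).convolutionExists_left _ (hρ.continuous_fderiv one_ne_zero) hf x
  rw [convolution_def, ContinuousLinearMap.integral_apply hint.integrable (bv j), convolution_def]
  simp only [precompL_apply, lsmul_apply]

omit [DecidableEq ι] in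
/-- **Word derivatives fall on the kernel**: `∂_v (ρ ⋆ f) = (∂_v ρ) ⋆ f` for a smooth compactly
supported kernel and a locally integrable `f` (Evans, *PDE*, App. C.4, Thm. 7 (i), iterated).
[cite: Evans2010, App. C.4 Thm. 7] -/
theorem cwd_convolution_eq_convolution_cwd_kernel {ρ : EuclideanSpace ℝ ι → ℝ}
    (hρ : ContDiff ℝ ∞ ρ) (hρc : HasCompactSupport ρ) {f : EuclideanSpace ℝ ι → W}
    (hf : LocallyIntegrable f (volume : Measure (EuclideanSpace ℝ ι))) (v : List ι) :
    cwd v (ρ ⋆[lsmul ℝ ℝ, volume] f) = (cwd v ρ) ⋆[lsmul ℝ ℝ, volume] f := by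
  induction v with
  | nil => rfl
  | cons j v ih =>
    funext x
    rw [cwd_cons, ih, cwd_cons]
    exact fderiv_convolution_kernel_apply ((contDiff_cwd hρ v).of_le (by norm_cast))
      (hasCompactSupport_cwd hρc v) hf x j

omit [DecidableEq ι] in
/-- The mollification of a locally integrable field by a smooth compactly supported kernel is
smooth (Mathlib's `HasCompactSupport.contDiff_convolution_left`). [cite: Evans2010, App. C.4 Thm. 7] -/
theorem contDiff_convolution_kernel {ρ : EuclideanSpace ℝ ι → ℝ} (hρ : ContDiff ℝ ∞ ρ)
    (hρc : HasCompactSupport ρ) {f : EuclideanSpace ℝ ι → W}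
    (hf : LocallyIntegrable f (volume : Measure (EuclideanSpace ℝ ι))) :
    ContDiff ℝ ∞ (ρ ⋆[lsmul ℝ ℝ, volume] f) :=
  hρc.contDiff_convolution_left _ hρ hf

end KernelDeriv

/-! ### Young: `‖ρ ⋆ f‖₂ ≤ ‖ρ‖₁ ‖f‖₂` -/

section Young

omit [DecidableEq ι] in
/-- The `L¹` mass `∫ |ρ|` of a continuous compactly supported kernel is finite and equals
`(∫⁻ ‖ρ‖ₑ).toReal`. [folklore] -/
theorem lintegral_enorm_kernel_eq {ρ : EuclideanSpace ℝ ι → ℝ} (hρ : Continuous ρ)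
    (hρc : HasCompactSupport ρ) :
    ∫⁻ y, ‖ρ y‖ₑ ∂(volume : Measure (EuclideanSpace ℝ ι)) = ENNReal.ofReal (∫ y, |ρ y|) := by
  have hint : Integrable ρ (volume : Measure (EuclideanSpace ℝ ι)) :=
    hρ.integrable_of_hasCompactSupport hρc
  rw [← ofReal_integral_norm_eq_lintegral_enorm hint]
  rfl

omit [DecidableEq ι] in
/-- **Young's inequality for a kernel** (Evans, *PDE*, App. C.4; Adams 1975, Lemma 2.18): for a
continuous compactly supported real kernel `ρ` and `f ∈ L²`, `ρ ⋆ f ∈ L²` and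
`‖ρ ⋆ f‖₂ ≤ (∫ |ρ|) ‖f‖₂`. [cite: Adams1975, Lemma 2.18] -/
theorem memLp_convolution_kernel {ρ : EuclideanSpace ℝ ι → ℝ} (hρ : Continuous ρ)
    (hρc : HasCompactSupport ρ) {f : EuclideanSpace ℝ ι → W}
    (hf : MemLp f 2 (volume : Measure (EuclideanSpace ℝ ι))) :
    MemLp (ρ ⋆[lsmul ℝ ℝ, volume] f) 2 (volume : Measure (EuclideanSpace ℝ ι)) ∧
      l2norm (ρ ⋆[lsmul ℝ ℝ, volume] f) ≤ (∫ y, |ρ y|) * l2norm f := by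
  have hint : Integrable ρ (volume : Measure (EuclideanSpace ℝ ι)) :=
    hρ.integrable_of_hasCompactSupport hρc
  have hmem := UnboundedOperators.memLp_convolution_lsmul hint hf one_le_two
  refine ⟨hmem, ?_⟩
  have hle := UnboundedOperators.eLpNorm_convolution_le_lintegral_enorm_mul
    (μ := (volume : Measure (EuclideanSpace ℝ ι))) hρ.aestronglyMeasurable hf.aestronglyMeasurable
    one_le_two (K := ρ) (f := f)
  rw [lintegral_enorm_kernel_eq hρ hρc] at hle
  rw [l2norm_def, l2norm_def]
  have habs : 0 ≤ ∫ y, |ρ y| := integral_nonneg fun _ ↦ abs_nonneg _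
  calc (eLpNorm (ρ ⋆[lsmul ℝ ℝ, volume] f) 2 volume).toReal
      ≤ (ENNReal.ofReal (∫ y, |ρ y|) * eLpNorm f 2 volume).toReal :=
        ENNReal.toReal_mono (ENNReal.mul_ne_top ENNReal.ofReal_ne_top hf.eLpNorm_ne_top) hle
    _ = (∫ y, |ρ y|) * (eLpNorm f 2 volume).toReal := by
        rw [ENNReal.toReal_mul, ENNReal.toReal_ofReal habs]

omit [DecidableEq ι] in
/-- **Mollification does not increase the `L²` norm**: for a bump `φ` centred at `0`,
`φ.normed ⋆ f ∈ L²` with `‖φ.normed ⋆ f‖₂ ≤ ‖f‖₂` (unit mass, nonnegative kernel).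
[cite: Evans2010, App. C.4 Thm. 7] -/
theorem memLp_normed_convolution_and_l2norm_le (φ : ContDiffBump (0 : EuclideanSpace ℝ ι))
    {f : EuclideanSpace ℝ ι → W} (hf : MemLp f 2 (volume : Measure (EuclideanSpace ℝ ι))) :
    MemLp (φ.normed volume ⋆[lsmul ℝ ℝ, volume] f) 2 (volume : Measure (EuclideanSpace ℝ ι)) ∧
      l2norm (φ.normed volume ⋆[lsmul ℝ ℝ, volume] f) ≤ l2norm f := by
  obtain ⟨hmem, hle⟩ := memLp_convolution_kernel
    (φ.contDiff_normed (μ := (volume : Measure (EuclideanSpace ℝ ι))) (n := 0)).continuous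
    φ.hasCompactSupport_normed hf
  refine ⟨hmem, hle.trans ?_⟩
  have h1 : (∫ y, |φ.normed volume y|) = 1 := by
    have : (fun y ↦ |φ.normed volume y|) = φ.normed volume := by
      funext y; exact abs_of_nonneg (φ.nonneg_normed y)
    rw [this, φ.integral_normed]
  rw [h1, one_mul]

end Young

/-! ### Cauchy–Schwarz pointwise: `‖(ρ ⋆ f)(x)‖ ≤ ‖ρ‖₂ ‖f‖₂` -/

section Pointwise

omit [DecidableEq ι] [NormedSpace ℝ W] in
/-- The translate-reflection `t ↦ f (x - t)` of an `L²` field is in `L²` with the same norm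
(invariance of Lebesgue measure). [folklore] -/
theorem memLp_comp_sub_left {f : EuclideanSpace ℝ ι → W}
    (hf : MemLp f 2 (volume : Measure (EuclideanSpace ℝ ι))) (x : EuclideanSpace ℝ ι) :
    MemLp (fun t ↦ f (x - t)) 2 (volume : Measure (EuclideanSpace ℝ ι)) ∧
      l2norm (fun t ↦ f (x - t)) = l2norm f := by
  have hmp := Measure.measurePreserving_sub_left (volume : Measure (EuclideanSpace ℝ ι)) x
  refine ⟨hf.comp_measurePreserving hmp, ?_⟩
  rw [l2norm_def, l2norm_def]
  congr 1
  exact eLpNorm_comp_measurePreserving hf.aestronglyMeasurable hmp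

omit [DecidableEq ι] in
/-- **Pointwise Cauchy–Schwarz for a mollification**: for a continuous compactly supported real
kernel `ρ` and `f ∈ L²`, `‖(ρ ⋆ f)(x)‖ ≤ ‖ρ‖₂ ‖f‖₂` at every point — mollified `L²` fields are
bounded, and the evaluation `f ↦ (ρ ⋆ f)(x)` is a bounded linear functional on `L²`.
[cite: Evans2010, App. C.4 Thm. 7] -/
theorem norm_convolution_kernel_apply_le {ρ : EuclideanSpace ℝ ι → ℝ} (hρ : Continuous ρ)
    (hρc : HasCompactSupport ρ) {f : EuclideanSpace ℝ ι → W}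
    (hf : MemLp f 2 (volume : Measure (EuclideanSpace ℝ ι))) (x : EuclideanSpace ℝ ι) :
    ‖(ρ ⋆[lsmul ℝ ℝ, volume] f) x‖ ≤ l2norm ρ * l2norm f := by
  obtain ⟨hfx, hfxn⟩ := memLp_comp_sub_left hf x
  have hρ2 : MemLp ρ 2 (volume : Measure (EuclideanSpace ℝ ι)) :=
    hρ.memLp_of_hasCompactSupport hρc
  have habsρ : MemLp (fun t ↦ |ρ t|) 2 (volume : Measure (EuclideanSpace ℝ ι)) := hρ2.abs
  have hnf : MemLp (fun t ↦ ‖f (x - t)‖) 2 (volume : Measure (EuclideanSpace ℝ ι)) := hfx.norm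
  rw [convolution_def]
  calc ‖∫ t, (lsmul ℝ ℝ) (ρ t) (f (x - t))‖
      ≤ ∫ t, ‖(lsmul ℝ ℝ) (ρ t) (f (x - t))‖ := norm_integral_le_integral_norm _
    _ = ∫ t, ⟪|ρ t|, ‖f (x - t)‖⟫ := by
        refine integral_congr_ae (Eventually.of_forall fun t ↦ ?_)
        simp only [lsmul_apply, norm_smul, Real.norm_eq_abs]
        rw [RCLike.inner_apply, conj_trivial, mul_comm]
    _ ≤ |∫ t, ⟪|ρ t|, ‖f (x - t)‖⟫| := le_abs_self _
    _ ≤ l2norm (fun t ↦ |ρ t|) * l2norm (fun t ↦ ‖f (x - t)‖) :=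
        abs_integral_inner_le_l2norm habsρ hnf
    _ = l2norm ρ * l2norm f := by
        rw [← hfxn]
        simp only [l2norm_def, eLpNorm_norm]
        congr 2
        exact eLpNorm_congr_norm_ae (Eventually.of_forall fun t ↦ by simp)

omit [DecidableEq ι] in
/-- **Sup bound for the word derivatives of a mollified `L²` field**: `‖∂_v (ρ ⋆ f)(x)‖ ≤ ‖∂_v ρ‖₂ ‖f‖₂`.
[cite: Evans2010, App. C.4 Thm. 7] -/
theorem norm_cwd_convolution_kernel_apply_le {ρ : EuclideanSpace ℝ ι → ℝ} (hρ : ContDiff ℝ ∞ ρ)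
    (hρc : HasCompactSupport ρ) {f : EuclideanSpace ℝ ι → W}
    (hf : MemLp f 2 (volume : Measure (EuclideanSpace ℝ ι))) (v : List ι)
    (x : EuclideanSpace ℝ ι) :
    ‖cwd v (ρ ⋆[lsmul ℝ ℝ, volume] f) x‖ ≤ l2norm (cwd v ρ) * l2norm f := by
  rw [cwd_convolution_eq_convolution_cwd_kernel hρ hρc (hf.locallyIntegrable one_le_two) v]
  exact norm_convolution_kernel_apply_le (continuous_cwd hρ v) (hasCompactSupport_cwd hρc v) hf x

end Pointwise

/-! ### Derivatives of a mollified *smooth* field fall on the field -/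

section SmoothField

omit [DecidableEq ι] in
/-- **Differentiation under the convolution integral.** For a continuous compactly supported real
kernel `ρ` and a `C¹` field `h`, `ρ ⋆ h` has Fréchet derivative `∫ ρ(t) • Dh(x − t) dt` at every
point (dominated differentiation under the integral sign: on a bounded neighbourhood of `x₀` the
derivative of the integrand is bounded by `‖ρ‖ · sup ‖Dh‖` over a compact set).
[cite: Evans2010, App. C.4 Thm. 7] -/
theorem hasFDerivAt_convolution_kernel_of_contDiff {ρ : EuclideanSpace ℝ ι → ℝ} (hρ : Continuous ρ)
    (hρc : HasCompactSupport ρ) {h : EuclideanSpace ℝ ι → W} (hh : ContDiff ℝ 1 h)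
    (x₀ : EuclideanSpace ℝ ι) :
    HasFDerivAt (ρ ⋆[lsmul ℝ ℝ, volume] h)
      (∫ t, ρ t • fderiv ℝ h (x₀ - t) ∂(volume : Measure (EuclideanSpace ℝ ι))) x₀ := by
  -- a radius for the support of the kernel and a bound for `Dh` near `x₀`
  obtain ⟨R, hR⟩ := hρc.isCompact.isBounded.exists_norm_le
  obtain ⟨C₀, hC₀⟩ := (isCompact_closedBall x₀ (R + 1)).exists_bound_of_continuousOn
    ((hh.continuous_fderiv one_ne_zero).continuousOn)
  set C : ℝ := max C₀ 0 with hC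
  have hdh : Continuous (fderiv ℝ h) := hh.continuous_fderiv one_ne_zero
  have hsub : ∀ x : EuclideanSpace ℝ ι, Continuous fun t : EuclideanSpace ℝ ι ↦ x - t := fun x ↦
    continuous_const.sub continuous_id
  have hconv : (ρ ⋆[lsmul ℝ ℝ, volume] h) = fun x ↦ ∫ t, ρ t • h (x - t) := by
    funext x; rw [convolution_def]; rfl
  rw [hconv]
  refine hasFDerivAt_integral_of_dominated_of_fderiv_le (μ := (volume : Measure (EuclideanSpace ℝ ι)))
    (F := fun x t ↦ ρ t • h (x - t)) (F' := fun x t ↦ ρ t • fderiv ℝ h (x - t))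
    (x₀ := x₀) (s := ball x₀ 1) (bound := fun t ↦ ‖ρ t‖ * C) (ball_mem_nhds x₀ one_pos)
    ?_ ?_ ?_ ?_ ?_ ?_
  · exact Eventually.of_forall fun x ↦
      (hρ.smul (hh.continuous.comp (hsub x))).aestronglyMeasurable
  · refine (hρ.smul (hh.continuous.comp (hsub x₀))).integrable_of_hasCompactSupport ?_
    exact hρc.smul_right
  · exact (hρ.smul (hdh.comp (hsub x₀))).aestronglyMeasurable
  · refine Eventually.of_forall fun t x hx ↦ ?_
    by_cases ht : t ∈ tsupport ρ
    · rw [norm_smul]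
      refine mul_le_mul_of_nonneg_left ?_ (norm_nonneg _)
      have hmem : x - t ∈ closedBall x₀ (R + 1) := by
        rw [mem_closedBall, dist_eq_norm]
        have h1 : ‖x - x₀‖ < 1 := by rw [← dist_eq_norm]; exact hx
        calc ‖x - t - x₀‖ = ‖(x - x₀) - t‖ := by abel_nf
          _ ≤ ‖x - x₀‖ + ‖t‖ := norm_sub_le _ _
          _ ≤ R + 1 := by linarith [hR t ht]
      exact (hC₀ _ hmem).trans (le_max_left _ _)
    · rw [image_eq_zero_of_notMem_tsupport ht, zero_smul, norm_zero, norm_zero, zero_mul]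
  · exact ((hρ.norm.mul continuous_const)).integrable_of_hasCompactSupport (hρc.norm.mul_right)
  · refine Eventually.of_forall fun t x _ ↦ ?_
    have h1 : HasFDerivAt (fun y : EuclideanSpace ℝ ι ↦ y - t) (ContinuousLinearMap.id ℝ _) x :=
      (hasFDerivAt_id x).sub_const t
    have h2 : HasFDerivAt (fun y ↦ ρ t • h (y - t))
        (ρ t • (fderiv ℝ h (x - t)).comp (ContinuousLinearMap.id ℝ (EuclideanSpace ℝ ι))) x :=
      ((hh.differentiable one_ne_zero (x - t)).hasFDerivAt.comp x h1).const_smul (ρ t)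
    rwa [ContinuousLinearMap.comp_id] at h2

omit [DecidableEq ι] in
/-- **Derivatives of a mollified smooth field fall on the field**: for a continuous compactly
supported kernel `ρ` and a `C¹` field `h`, `D(ρ ⋆ h)(x) v = (ρ ⋆ (Dh · v))(x)`
(Evans, *PDE*, App. C.4, Thm. 7 (i), smooth case). [cite: Evans2010, App. C.4 Thm. 7] -/
theorem fderiv_convolution_kernel_of_contDiff_apply {ρ : EuclideanSpace ℝ ι → ℝ} (hρ : Continuous ρ)
    (hρc : HasCompactSupport ρ) {h : EuclideanSpace ℝ ι → W} (hh : ContDiff ℝ 1 h)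
    (x v : EuclideanSpace ℝ ι) :
    fderiv ℝ (ρ ⋆[lsmul ℝ ℝ, volume] h) x v =
      (ρ ⋆[lsmul ℝ ℝ, volume] fun y ↦ fderiv ℝ h y v) x := by
  rw [(hasFDerivAt_convolution_kernel_of_contDiff hρ hρc hh x).fderiv]
  have hint : Integrable (fun t ↦ ρ t • fderiv ℝ h (x - t)) (volume : Measure (EuclideanSpace ℝ ι)) := by
    refine ((hρ.smul ((hh.continuous_fderiv one_ne_zero).comp
      (continuous_const.sub continuous_id)))).integrable_of_hasCompactSupport ?_
    exact hρc.smul_right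
  rw [ContinuousLinearMap.integral_apply hint v, convolution_def]
  simp only [FunLike.coe_smul, Pi.smul_apply, lsmul_apply]

omit [DecidableEq ι] in
/-- **Word form**: `∂_v (ρ ⋆ h) = ρ ⋆ ∂_v h` for a continuous compactly supported kernel and a
smooth field `h`. [cite: Evans2010, App. C.4 Thm. 7] -/
theorem cwd_convolution_eq_convolution_cwd {ρ : EuclideanSpace ℝ ι → ℝ} (hρ : Continuous ρ)
    (hρc : HasCompactSupport ρ) {h : EuclideanSpace ℝ ι → W} (hh : ContDiff ℝ ∞ h) (v : List ι) :
    cwd v (ρ ⋆[lsmul ℝ ℝ, volume] h) = ρ ⋆[lsmul ℝ ℝ, volume] (cwd v h) := by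
  induction v with
  | nil => rfl
  | cons j v ih =>
    funext x
    rw [cwd_cons, ih, cwd_cons]
    exact fderiv_convolution_kernel_of_contDiff_apply hρ hρc
      ((contDiff_cwd hh v).of_le (by norm_cast)) x (bv j)

end SmoothField

/-! ### Self-adjointness on `L²` for an even kernel -/

section SelfAdjoint

variable {V : Type*} [NormedAddCommGroup V] [InnerProductSpace ℝ V] [CompleteSpace V]

omit [DecidableEq ι] [CompleteSpace V] in
/-- The kernel of the double integral behind self-adjointness is integrable on the product:
`(x, y) ↦ ρ(x − y) ⟪f x, g y⟫` for `ρ` continuous with compact support and `f, g ∈ L²`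
(`|ρ(x − y)| ‖f x‖ ‖g y‖ ≤ ½ |ρ(x − y)| (‖f x‖² + ‖g y‖²)` and Tonelli). [folklore] -/
theorem integrable_kernel_inner_prod {ρ : EuclideanSpace ℝ ι → ℝ} (hρ : Continuous ρ)
    (hρc : HasCompactSupport ρ) {f g : EuclideanSpace ℝ ι → V}
    (hf : MemLp f 2 (volume : Measure (EuclideanSpace ℝ ι)))
    (hg : MemLp g 2 (volume : Measure (EuclideanSpace ℝ ι))) :
    Integrable (fun p : EuclideanSpace ℝ ι × EuclideanSpace ℝ ι ↦ ρ (p.1 - p.2) * ⟪f p.1, g p.2⟫)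
      ((volume : Measure (EuclideanSpace ℝ ι)).prod volume) := by
  set μ : Measure (EuclideanSpace ℝ ι) := volume with hμ
  have hρint : Integrable ρ μ := hρ.integrable_of_hasCompactSupport hρc
  have hρabs : Integrable (fun t ↦ |ρ t|) μ := hρint.abs
  -- measurability
  have hmeasρ : AEStronglyMeasurable (fun p : EuclideanSpace ℝ ι × EuclideanSpace ℝ ι ↦ ρ (p.1 - p.2))
      (μ.prod μ) := (hρ.comp continuous_sub).aestronglyMeasurable
  have hmeasf : AEStronglyMeasurable (fun p : EuclideanSpace ℝ ι × EuclideanSpace ℝ ι ↦ f p.1)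
      (μ.prod μ) := hf.1.comp_quasiMeasurePreserving Measure.quasiMeasurePreserving_fst
  have hmeasg : AEStronglyMeasurable (fun p : EuclideanSpace ℝ ι × EuclideanSpace ℝ ι ↦ g p.2)
      (μ.prod μ) := hg.1.comp_quasiMeasurePreserving Measure.quasiMeasurePreserving_snd
  have hmeas : AEStronglyMeasurable
      (fun p : EuclideanSpace ℝ ι × EuclideanSpace ℝ ι ↦ ρ (p.1 - p.2) * ⟪f p.1, g p.2⟫) (μ.prod μ) :=
    hmeasρ.mul (hmeasf.inner hmeasg)
  -- the two dominating functions
  have hf2 : Integrable (fun x ↦ ‖f x‖ ^ 2) μ := (memLp_two_iff_integrable_sq_norm hf.1).1 hf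
  have hg2 : Integrable (fun y ↦ ‖g y‖ ^ 2) μ := (memLp_two_iff_integrable_sq_norm hg.1).1 hg
  have hb1 : Integrable (fun p : EuclideanSpace ℝ ι × EuclideanSpace ℝ ι ↦ |ρ (p.1 - p.2)| * ‖f p.1‖ ^ 2)
      (μ.prod μ) := by
    have hm : AEStronglyMeasurable
        (fun p : EuclideanSpace ℝ ι × EuclideanSpace ℝ ι ↦ |ρ (p.1 - p.2)| * ‖f p.1‖ ^ 2) (μ.prod μ) :=
      hmeasρ.norm.mul (hmeasf.norm.pow 2)
    refine (integrable_prod_iff hm).2 ⟨?_, ?_⟩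
    · refine Eventually.of_forall fun x ↦ ?_
      have h : Integrable (fun y ↦ |ρ (x - y)|) μ := hρabs.comp_sub_left x
      simpa [mul_comm] using h.const_mul (‖f x‖ ^ 2)
    · have heq : (fun x ↦ ∫ y, ‖|ρ (x - y)| * ‖f x‖ ^ 2‖ ∂μ) = fun x ↦ (∫ t, |ρ t| ∂μ) * ‖f x‖ ^ 2 := by
        funext x
        have h1 : (fun y ↦ ‖|ρ (x - y)| * ‖f x‖ ^ 2‖) = fun y ↦ |ρ (x - y)| * ‖f x‖ ^ 2 := by
          funext y; rw [Real.norm_of_nonneg (by positivity)]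
        rw [h1, integral_mul_const, integral_sub_left_eq_self (fun t ↦ |ρ t|) μ x]
      rw [heq]
      exact hf2.const_mul _
  have hb2 : Integrable (fun p : EuclideanSpace ℝ ι × EuclideanSpace ℝ ι ↦ |ρ (p.1 - p.2)| * ‖g p.2‖ ^ 2)
      (μ.prod μ) := by
    have hm : AEStronglyMeasurable
        (fun p : EuclideanSpace ℝ ι × EuclideanSpace ℝ ι ↦ |ρ (p.1 - p.2)| * ‖g p.2‖ ^ 2) (μ.prod μ) :=
      hmeasρ.norm.mul (hmeasg.norm.pow 2)
    refine (integrable_prod_iff' hm).2 ⟨?_, ?_⟩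
    · refine Eventually.of_forall fun y ↦ ?_
      have h : Integrable (fun x ↦ |ρ (x - y)|) μ := hρabs.comp_sub_right y
      simpa using h.mul_const (‖g y‖ ^ 2)
    · have heq : (fun y ↦ ∫ x, ‖|ρ (x - y)| * ‖g y‖ ^ 2‖ ∂μ) = fun y ↦ (∫ t, |ρ t| ∂μ) * ‖g y‖ ^ 2 := by
        funext y
        have h1 : (fun x ↦ ‖|ρ (x - y)| * ‖g y‖ ^ 2‖) = fun x ↦ |ρ (x - y)| * ‖g y‖ ^ 2 := by
          funext x; rw [Real.norm_of_nonneg (by positivity)]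
        rw [h1, integral_mul_const, integral_sub_right_eq_self (fun t ↦ |ρ t|) y]
      rw [heq]
      exact hg2.const_mul _
  refine Integrable.mono' ((hb1.add hb2).div_const 2) hmeas (Eventually.of_forall fun p ↦ ?_)
  rw [Real.norm_eq_abs, abs_mul]
  have hin : |⟪f p.1, g p.2⟫| ≤ ‖f p.1‖ * ‖g p.2‖ := abs_real_inner_le_norm _ _
  have hsq : ‖f p.1‖ * ‖g p.2‖ ≤ (‖f p.1‖ ^ 2 + ‖g p.2‖ ^ 2) / 2 := by
    nlinarith [sq_nonneg (‖f p.1‖ - ‖g p.2‖)]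
  calc |ρ (p.1 - p.2)| * |⟪f p.1, g p.2⟫|
      ≤ |ρ (p.1 - p.2)| * ((‖f p.1‖ ^ 2 + ‖g p.2‖ ^ 2) / 2) :=
        mul_le_mul_of_nonneg_left (hin.trans hsq) (abs_nonneg _)
    _ = (|ρ (p.1 - p.2)| * ‖f p.1‖ ^ 2 + |ρ (p.1 - p.2)| * ‖g p.2‖ ^ 2) / 2 := by ring

omit [DecidableEq ι] in
/-- **Mollification by an even kernel is self-adjoint on `L²`**: for `ρ` continuous, compactly
supported and even, and `f, g ∈ L²(ℝⁿ; V)`, `∫ ⟪f, ρ ⋆ g⟫ = ∫ ⟪ρ ⋆ f, g⟫` (Fubini for the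
kernel `ρ(x − y) ⟪f x, g y⟫`; Evans, *PDE*, App. C.4). [cite: Evans2010, App. C.4 Thm. 7] -/
theorem integral_inner_convolution_kernel_comm {ρ : EuclideanSpace ℝ ι → ℝ} (hρ : Continuous ρ)
    (hρc : HasCompactSupport ρ) (heven : ∀ x, ρ (-x) = ρ x) {f g : EuclideanSpace ℝ ι → V}
    (hf : MemLp f 2 (volume : Measure (EuclideanSpace ℝ ι)))
    (hg : MemLp g 2 (volume : Measure (EuclideanSpace ℝ ι))) :
    ∫ x, ⟪f x, (ρ ⋆[lsmul ℝ ℝ, volume] g) x⟫ = ∫ y, ⟪(ρ ⋆[lsmul ℝ ℝ, volume] f) y, g y⟫ := by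
  set μ : Measure (EuclideanSpace ℝ ι) := volume with hμ
  have hρint : Integrable ρ μ := hρ.integrable_of_hasCompactSupport hρc
  have hfl : LocallyIntegrable f μ := hf.locallyIntegrable one_le_two
  have hgl : LocallyIntegrable g μ := hg.locallyIntegrable one_le_two
  -- the two convolutions as integrals against `ρ(x - y)`
  have hcg : ∀ x, (ρ ⋆[lsmul ℝ ℝ, μ] g) x = ∫ y, ρ (x - y) • g y ∂μ := fun x ↦ by
    rw [convolution_eq_swap]; rfl
  have hcf : ∀ y, (ρ ⋆[lsmul ℝ ℝ, μ] f) y = ∫ x, ρ (x - y) • f x ∂μ := fun y ↦ by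
    rw [convolution_eq_swap]
    refine integral_congr_ae (Eventually.of_forall fun x ↦ ?_)
    change ρ (y - x) • f x = ρ (x - y) • f x
    rw [← neg_sub x y, heven]
  -- integrability of the slices
  have hint_g : ∀ x, Integrable (fun y ↦ ρ (x - y) • g y) μ := fun x ↦ by
    have h := (hρc.convolutionExists_left (lsmul ℝ ℝ : ℝ →L[ℝ] V →L[ℝ] V) hρ hgl x).integrable_swap
    simpa [lsmul_apply] using h
  have hint_f : ∀ y, Integrable (fun x ↦ ρ (x - y) • f x) μ := fun y ↦ by
    have h := (hρc.convolutionExists_left (lsmul ℝ ℝ : ℝ →L[ℝ] V →L[ℝ] V) hρ hfl y).integrable_swap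
    have h' : Integrable (fun x ↦ ρ (y - x) • f x) μ := by simpa [lsmul_apply] using h
    refine h'.congr (Eventually.of_forall fun x ↦ ?_)
    change ρ (y - x) • f x = ρ (x - y) • f x
    rw [← neg_sub x y, heven]
  -- rewrite both sides as double integrals of the same kernel
  have hL : (∫ x, ⟪f x, (ρ ⋆[lsmul ℝ ℝ, μ] g) x⟫ ∂μ) = ∫ x, ∫ y, ρ (x - y) * ⟪f x, g y⟫ ∂μ ∂μ := by
    refine integral_congr_ae (Eventually.of_forall fun x ↦ ?_)
    change ⟪f x, (ρ ⋆[lsmul ℝ ℝ, μ] g) x⟫ = ∫ y, ρ (x - y) * ⟪f x, g y⟫ ∂μ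
    rw [hcg x, ← integral_inner (hint_g x)]
    refine integral_congr_ae (Eventually.of_forall fun y ↦ ?_)
    simp only [inner_smul_right]
  have hR : (∫ y, ⟪(ρ ⋆[lsmul ℝ ℝ, μ] f) y, g y⟫ ∂μ) = ∫ y, ∫ x, ρ (x - y) * ⟪f x, g y⟫ ∂μ ∂μ := by
    refine integral_congr_ae (Eventually.of_forall fun y ↦ ?_)
    change ⟪(ρ ⋆[lsmul ℝ ℝ, μ] f) y, g y⟫ = ∫ x, ρ (x - y) * ⟪f x, g y⟫ ∂μ
    rw [hcf y, real_inner_comm, ← integral_inner (hint_f y)]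
    refine integral_congr_ae (Eventually.of_forall fun x ↦ ?_)
    simp only [inner_smul_right, real_inner_comm]
  rw [hL, hR]
  exact integral_integral_swap (integrable_kernel_inner_prod hρ hρc hf hg)

omit [DecidableEq ι] in
/-- **Self-adjointness of the normalised bump mollifier on `L²`**: `∫ ⟪f, φ.normed ⋆ g⟫ =
∫ ⟪φ.normed ⋆ f, g⟫` (the bump is centred at `0` and even). [cite: Evans2010, App. C.4 Thm. 7] -/
theorem integral_inner_normed_convolution_comm (φ : ContDiffBump (0 : EuclideanSpace ℝ ι))
    {f g : EuclideanSpace ℝ ι → V} (hf : MemLp f 2 (volume : Measure (EuclideanSpace ℝ ι)))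
    (hg : MemLp g 2 (volume : Measure (EuclideanSpace ℝ ι))) :
    ∫ x, ⟪f x, (φ.normed volume ⋆[lsmul ℝ ℝ, volume] g) x⟫ =
      ∫ y, ⟪(φ.normed volume ⋆[lsmul ℝ ℝ, volume] f) y, g y⟫ :=
  integral_inner_convolution_kernel_comm
    (φ.contDiff_normed (μ := (volume : Measure (EuclideanSpace ℝ ι))) (n := 0)).continuous
    φ.hasCompactSupport_normed (φ.normed_neg) hf hg

end SelfAdjoint

/-! ### The operators on the Hilbert space `L²(ℝⁿ; W)` -/

section LpOps

omit [DecidableEq ι] in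
/-- Changing an `L²` field on a null set does not change its mollification (anywhere).
[folklore] -/
theorem convolution_kernel_congr_ae {ρ : EuclideanSpace ℝ ι → ℝ} {f g : EuclideanSpace ℝ ι → W}
    (h : f =ᵐ[(volume : Measure (EuclideanSpace ℝ ι))] g) :
    ρ ⋆[lsmul ℝ ℝ, volume] f = ρ ⋆[lsmul ℝ ℝ, volume] g :=
  convolution_congr (lsmul ℝ ℝ) EventuallyEq.rfl h

/-- **Mollification as a bounded operator on `L²(ℝⁿ; W)`**: `U ↦ ρ ⋆ U` for a continuous compactly
supported real kernel, of norm `≤ ∫ |ρ|` (Young). Its values are represented by the smooth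
functions `ρ ⋆ ⇑U` (`coeFn_convL2`). [cite: Adams1975, Lemma 2.18] -/
def convL2 (ρ : EuclideanSpace ℝ ι → ℝ) (hρ : Continuous ρ) (hρc : HasCompactSupport ρ) :
    Lp W 2 (volume : Measure (EuclideanSpace ℝ ι)) →L[ℝ] Lp W 2 (volume : Measure (EuclideanSpace ℝ ι)) :=
  LinearMap.mkContinuous
    { toFun := fun U ↦ (memLp_convolution_kernel hρ hρc (Lp.memLp U)).1.toLp _
      map_add' := fun U V ↦ by
        have hU := Lp.memLp U
        have hV := Lp.memLp V
        have hexU : ConvolutionExists ρ (U : EuclideanSpace ℝ ι → W) (lsmul ℝ ℝ) volume :=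
          hρc.convolutionExists_left _ hρ (hU.locallyIntegrable one_le_two)
        have hexV : ConvolutionExists ρ (V : EuclideanSpace ℝ ι → W) (lsmul ℝ ℝ) volume :=
          hρc.convolutionExists_left _ hρ (hV.locallyIntegrable one_le_two)
        have heq : ρ ⋆[lsmul ℝ ℝ, volume] ((U + V : Lp W 2 volume) : EuclideanSpace ℝ ι → W) =
            ρ ⋆[lsmul ℝ ℝ, volume] (U : EuclideanSpace ℝ ι → W) +
              ρ ⋆[lsmul ℝ ℝ, volume] (V : EuclideanSpace ℝ ι → W) := by
          rw [convolution_kernel_congr_ae (Lp.coeFn_add U V)]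
          exact hexU.distrib_add hexV
        rw [← MemLp.toLp_add]
        exact MemLp.toLp_congr _ _ (Eventually.of_forall fun x ↦ by rw [heq])
      map_smul' := fun c U ↦ by
        have heq : ρ ⋆[lsmul ℝ ℝ, volume] ((c • U : Lp W 2 volume) : EuclideanSpace ℝ ι → W) =
            c • (ρ ⋆[lsmul ℝ ℝ, volume] (U : EuclideanSpace ℝ ι → W)) := by
          rw [convolution_kernel_congr_ae (Lp.coeFn_smul c U)]
          exact convolution_smul
        rw [RingHom.id_apply, ← MemLp.toLp_const_smul]
        exact MemLp.toLp_congr _ _ (Eventually.of_forall fun x ↦ by rw [heq]) }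
    (∫ y, |ρ y|) fun U ↦ by
      simp only [LinearMap.coe_mk, AddHom.coe_mk, Lp.norm_toLp]
      have h := (memLp_convolution_kernel hρ hρc (Lp.memLp U)).2
      rw [l2norm_def, l2norm_def] at h
      rwa [Lp.norm_def]

omit [DecidableEq ι] in
/-- The values of `convL2` are represented by the smooth mollifications: `⇑(convL2 ρ U) = ρ ⋆ ⇑U`
almost everywhere. [folklore] -/
theorem coeFn_convL2 {ρ : EuclideanSpace ℝ ι → ℝ} (hρ : Continuous ρ) (hρc : HasCompactSupport ρ)
    (U : Lp W 2 (volume : Measure (EuclideanSpace ℝ ι))) :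
    (convL2 ρ hρ hρc U : EuclideanSpace ℝ ι → W) =ᵐ[(volume : Measure (EuclideanSpace ℝ ι))]
      ρ ⋆[lsmul ℝ ℝ, volume] (U : EuclideanSpace ℝ ι → W) :=
  MemLp.coeFn_toLp (memLp_convolution_kernel hρ hρc (Lp.memLp U)).1

omit [DecidableEq ι] in
/-- Mollifying a value of `convL2` by a second kernel sees the smooth representative:
`ρ' ⋆ ⇑(convL2 ρ U) = ρ' ⋆ (ρ ⋆ ⇑U)` (everywhere). [folklore] -/
theorem convolution_coeFn_convL2 {ρ ρ' : EuclideanSpace ℝ ι → ℝ} (hρ : Continuous ρ)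
    (hρc : HasCompactSupport ρ) (U : Lp W 2 (volume : Measure (EuclideanSpace ℝ ι))) :
    ρ' ⋆[lsmul ℝ ℝ, volume] (convL2 ρ hρ hρc U : EuclideanSpace ℝ ι → W) =
      ρ' ⋆[lsmul ℝ ℝ, volume] (ρ ⋆[lsmul ℝ ℝ, volume] (U : EuclideanSpace ℝ ι → W)) :=
  convolution_kernel_congr_ae (coeFn_convL2 hρ hρc U)

omit [DecidableEq ι] in
/-- The norm of `convL2 ρ U` is the `L²` norm of the smooth representative `ρ ⋆ ⇑U`. [folklore] -/
theorem norm_convL2_eq {ρ : EuclideanSpace ℝ ι → ℝ} (hρ : Continuous ρ) (hρc : HasCompactSupport ρ)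
    (U : Lp W 2 (volume : Measure (EuclideanSpace ℝ ι))) :
    ‖convL2 ρ hρ hρc U‖ = l2norm (ρ ⋆[lsmul ℝ ℝ, volume] (U : EuclideanSpace ℝ ι → W)) :=
  Lp.norm_toLp _ (memLp_convolution_kernel hρ hρc (Lp.memLp U)).1

omit [DecidableEq ι] in
/-- Operator-norm bound for `convL2`: `‖ρ ⋆ U‖₂ ≤ (∫ |ρ|) ‖U‖₂`. [cite: Adams1975, Lemma 2.18] -/
theorem norm_convL2_le {ρ : EuclideanSpace ℝ ι → ℝ} (hρ : Continuous ρ) (hρc : HasCompactSupport ρ)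
    (U : Lp W 2 (volume : Measure (EuclideanSpace ℝ ι))) :
    ‖convL2 ρ hρ hρc U‖ ≤ (∫ y, |ρ y|) * ‖U‖ := by
  rw [norm_convL2_eq, Lp.norm_def, ← l2norm_def]
  exact (memLp_convolution_kernel hρ hρc (Lp.memLp U)).2

/-- **Point evaluation of a mollification as a bounded functional on `L²`**: `U ↦ (ρ ⋆ U)(x)`,
of norm `≤ ‖ρ‖₂` (Cauchy–Schwarz; `norm_convolution_kernel_apply_le`). Through it, pointwise
values of mollified `L²`-valued curves are differentiated in time. [cite: Evans2010, App. C.4 Thm. 7] -/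
def evalL2 (ρ : EuclideanSpace ℝ ι → ℝ) (hρ : Continuous ρ) (hρc : HasCompactSupport ρ)
    (x : EuclideanSpace ℝ ι) : Lp W 2 (volume : Measure (EuclideanSpace ℝ ι)) →L[ℝ] W :=
  LinearMap.mkContinuous
    { toFun := fun U ↦ (ρ ⋆[lsmul ℝ ℝ, volume] (U : EuclideanSpace ℝ ι → W)) x
      map_add' := fun U V ↦ by
        have hU := Lp.memLp U
        have hV := Lp.memLp V
        have hexU : ConvolutionExists ρ (U : EuclideanSpace ℝ ι → W) (lsmul ℝ ℝ) volume :=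
          hρc.convolutionExists_left _ hρ (hU.locallyIntegrable one_le_two)
        have hexV : ConvolutionExists ρ (V : EuclideanSpace ℝ ι → W) (lsmul ℝ ℝ) volume :=
          hρc.convolutionExists_left _ hρ (hV.locallyIntegrable one_le_two)
        change (ρ ⋆[lsmul ℝ ℝ, volume] ((U + V : Lp W 2 volume) : EuclideanSpace ℝ ι → W)) x = _
        rw [convolution_kernel_congr_ae (Lp.coeFn_add U V), hexU.distrib_add hexV]
        rfl
      map_smul' := fun c U ↦ by
        change (ρ ⋆[lsmul ℝ ℝ, volume] ((c • U : Lp W 2 volume) : EuclideanSpace ℝ ι → W)) x = _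
        rw [convolution_kernel_congr_ae (Lp.coeFn_smul c U), convolution_smul]
        rfl }
    (l2norm ρ) fun U ↦ by
      simp only [LinearMap.coe_mk, AddHom.coe_mk]
      have h := norm_convolution_kernel_apply_le hρ hρc (Lp.memLp U) x
      rwa [Lp.norm_def, ← l2norm_def]

omit [DecidableEq ι] in
/-- Unfolding of `evalL2`. [folklore] -/
@[simp]
theorem evalL2_apply {ρ : EuclideanSpace ℝ ι → ℝ} (hρ : Continuous ρ) (hρc : HasCompactSupport ρ)
    (x : EuclideanSpace ℝ ι) (U : Lp W 2 (volume : Measure (EuclideanSpace ℝ ι))) :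
    evalL2 ρ hρ hρc x U = (ρ ⋆[lsmul ℝ ℝ, volume] (U : EuclideanSpace ℝ ι → W)) x := rfl

end LpOps

end Literature.Analysis.PDE

end
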